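import Mathlib.Analysis.InnerProductSpace.Calculus
import Mathlib.Analysis.Calculus.Deriv.MeanValue
import Mathlib.Analysis.SpecialFunctions.ExpDeriv
import Mathlib.Analysis.Complex.RealDeriv
import HarnessLib

/-!
# K2R `RealisedQuasiStaticCellLaw`, line `floquet-bloch`, stub `stub_lowSectorDecay` (S1D): the slaved-ladder Lyapunov
# functional, I — elementary lemmas and the slow-mode identity

Summits-side helper (everything proved; no definitions, no named facts; `--supports stmt-AnomalousDissipation-20446`).
First of three files (`…SlavedLadderSlow`, `…SlavedLadderFast`, `…SlavedLadder`) building the WEAK-coupling companion of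
brick (F2) `ladderFunctional_decay_intWindow`: for the three-term ladder
`v_J' = −Λ(d_J v_J + g(t)(s_{J−1} v_{J−1} − s_J v_{J+1}))` on a window `W ∋ 0, ±1`, the functional
`Φ = ‖v₀‖² + β Σ_{J≠0} ‖v_J − h_J v₀‖²` with the first-order slaving profile `h₁ = −g s₀/(d₁−d₀)`, `h₋₁ = g s₋₁/(d₋₁−d₀)`
(composite slow/fast Lyapunov function of singular-perturbation type for the one-column Riccati slaving of
`Literature.Analysis.ODE.SlowColumnSlaving`) decays at the second-order Taylor rate `Λ(d₀ + (1−ε)σ g²)`,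
`σ = s₋₁²/(d₋₁−d₀) + s₀²/(d₁−d₀)`, with an overhead paid once (in `β`), not once per window.

This file: the exchange identity of a real-link ladder on an integer window (`re_sum_conj_mul_link_eq_zero`), two
Cauchy–Schwarz one-liners, an AM–GM one-liner, and the SLOW-MODE bound (`slavedLadder_slow_le`): with
`X₁ = s₋₁ r₋₁ − s₀ r₁` (`r_J = v_J − h_J v₀`) one has EXACTLY `s₋₁ v₋₁ − s₀ v₁ = X₁ + g σ v₀`, hence
`2 Re(v₀' conj v₀) ≤ −2Λ(d₀ + g²σ)‖v₀‖² + 2|g|Λγ ‖v₀‖ √F`, `F = Σ_{J≠0} ‖r_J‖²`, `γ² = s₀² + s₋₁²`.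
-/

set_option linter.dupNamespace false -- layout D-0017: `AnomalousDissipation.AnomalousDissipation` repeats by design

namespace Summit.AnomalousDissipation.AnomalousDissipation.Theorems.SolenoidalFractalHomogenisation.RealisedQuasiStaticCellLaw

noncomputable section

open Set Finset Complex
open scoped BigOperators ComplexConjugate

/-! ## §0 Elementary lemmas -/

/-- `2c ≤ P + Q` when `c² ≤ P·Q` and `P, Q, c ≥ 0` (AM–GM). -/
theorem two_mul_le_add_of_sq_le_mul {P Q c : ℝ} (hP : 0 ≤ P) (hQ : 0 ≤ Q)
    (h : c ^ 2 ≤ P * Q) : 2 * c ≤ P + Q := by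
  nlinarith [sq_nonneg (P - Q), sq_nonneg (P + Q - 2 * c), sq_nonneg (P + Q), hP, hQ]

/-- Two-term Cauchy–Schwarz for norms: `‖a x − b y‖ ≤ √(a² + b²) · √(‖x‖² + ‖y‖²)` (`a, b` real). -/
theorem norm_sub_two_le_sqrt (a b : ℝ) (x y : ℂ) :
    ‖(a : ℂ) * x - (b : ℂ) * y‖ ≤ Real.sqrt (a ^ 2 + b ^ 2) * Real.sqrt (‖x‖ ^ 2 + ‖y‖ ^ 2) := by
  have h1 : ‖(a : ℂ) * x - (b : ℂ) * y‖ ≤ |a| * ‖x‖ + |b| * ‖y‖ := by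
    refine (norm_sub_le _ _).trans ?_
    rw [norm_mul, norm_mul, Complex.norm_real, Complex.norm_real, Real.norm_eq_abs, Real.norm_eq_abs]
  have h2 : (|a| * ‖x‖ + |b| * ‖y‖) ^ 2 ≤ (a ^ 2 + b ^ 2) * (‖x‖ ^ 2 + ‖y‖ ^ 2) := by
    nlinarith [sq_nonneg (|a| * ‖y‖ - |b| * ‖x‖), sq_abs a, sq_abs b, abs_nonneg a, abs_nonneg b,
      norm_nonneg x, norm_nonneg y]
  have h3 : 0 ≤ |a| * ‖x‖ + |b| * ‖y‖ := by positivity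
  calc ‖(a : ℂ) * x - (b : ℂ) * y‖ ≤ |a| * ‖x‖ + |b| * ‖y‖ := h1
    _ = Real.sqrt ((|a| * ‖x‖ + |b| * ‖y‖) ^ 2) := (Real.sqrt_sq h3).symm
    _ ≤ Real.sqrt ((a ^ 2 + b ^ 2) * (‖x‖ ^ 2 + ‖y‖ ^ 2)) := Real.sqrt_le_sqrt h2
    _ = Real.sqrt (a ^ 2 + b ^ 2) * Real.sqrt (‖x‖ ^ 2 + ‖y‖ ^ 2) := Real.sqrt_mul (by positivity) _

/-- The exchange term of a three-term ladder with REAL links is invisible in the energy: for a sequence `R` vanishing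
off a finite set `A`, `Re Σ_{J∈A} conj(R_J)(s_{J−1} R_{J−1} − s_J R_{J+1}) = 0` (index shift). -/
theorem re_sum_conj_mul_link_eq_zero (A : Finset ℤ) (s : ℤ → ℝ) (R : ℤ → ℂ)
    (hR : ∀ K, K ∉ A → R K = 0) :
    (∑ J ∈ A, conj (R J) * (((s (J - 1) : ℝ) : ℂ) * R (J - 1) - ((s J : ℝ) : ℂ) * R (J + 1))).re = 0 := by
  classical
  -- the summand `f K = s_K R_K conj(R_{K+1})`
  set f : ℤ → ℂ := fun K => ((s K : ℝ) : ℂ) * R K * conj (R (K + 1)) with hf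
  set T : ℂ := ∑ J ∈ A, conj (R J) * (((s J : ℝ) : ℂ) * R (J + 1)) with hT
  set U : ℂ := ∑ J ∈ A, conj (R J) * (((s (J - 1) : ℝ) : ℂ) * R (J - 1)) with hU
  have hsplit : ∑ J ∈ A, conj (R J) * (((s (J - 1) : ℝ) : ℂ) * R (J - 1) - ((s J : ℝ) : ℂ) * R (J + 1)) = U - T := by
    rw [hU, hT, ← Finset.sum_sub_distrib]
    refine Finset.sum_congr rfl fun J _ => ?_
    ring
  -- `conj T = Σ_{J∈A} f J`
  have hconjT : conj T = ∑ J ∈ A, f J := by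
    rw [hT, map_sum]
    refine Finset.sum_congr rfl fun J _ => ?_
    simp only [hf, map_mul, Complex.conj_conj, Complex.conj_ofReal]
    ring
  -- `U = Σ_{J∈A} f (J - 1)`
  have hU' : U = ∑ J ∈ A, f (J - 1) := by
    rw [hU]
    refine Finset.sum_congr rfl fun J _ => ?_
    simp only [hf, sub_add_cancel]
    ring
  -- both sums extend to the common set `B = A ∪ A.image (· - 1)`
  set B : Finset ℤ := A ∪ A.image (fun J => J - 1) with hB
  have hf0 : ∀ K, K ∉ A → f K = 0 := fun K hK => by simp only [hf, hR K hK, mul_zero, zero_mul]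
  have hf0' : ∀ K, K + 1 ∉ A → f K = 0 := fun K hK => by simp only [hf, hR (K + 1) hK, map_zero, mul_zero]
  have h1 : ∑ J ∈ A, f J = ∑ J ∈ B, f J :=
    Finset.sum_subset Finset.subset_union_left fun K _ hK => hf0 K hK
  have h2 : ∑ J ∈ A, f (J - 1) = ∑ K ∈ A.image (fun J => J - 1), f K := by
    rw [Finset.sum_image]
    intro x _ y _ h
    simpa using h
  have h3 : ∑ K ∈ A.image (fun J => J - 1), f K = ∑ K ∈ B, f K := by
    refine Finset.sum_subset Finset.subset_union_right fun K _ hK => hf0' K ?_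
    intro hK1
    apply hK
    exact Finset.mem_image.2 ⟨K + 1, hK1, by ring⟩
  have hUT : U = conj T := by rw [hU', h2, h3, hconjT, h1]
  rw [hsplit, hUT, Complex.sub_re, Complex.conj_re, sub_self]


/-! ## §1 The slow-mode bound -/

/-- **Slow-mode bound of the slaved ladder.** At one instant: state `x` (window `W ∋ ±1`), slow field value
`Fv₀ = −Λ d₀ x₀ − gΛ(s₋₁ x₋₁ − s₀ x₁)`, slaving profile `hf`. Then, with `F = Σ_{J∈W∖0} ‖x_J − hf_J x₀‖²`,
`2 Re(Fv₀ conj x₀) ≤ −2Λ(d₀ + g²σ)‖x₀‖² + 2(|g| Λ γ ‖x₀‖ √F)` — the second-order slaving identity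
`s₋₁ x₋₁ − s₀ x₁ = (s₋₁ r₋₁ − s₀ r₁) + g σ x₀` and Cauchy–Schwarz. -/
theorem slavedLadder_slow_le (W : Finset ℤ) (h1 : (1 : ℤ) ∈ W) (hm1 : (-1 : ℤ) ∈ W)
    (d s : ℤ → ℝ) (Λ γ σ gt : ℝ) (x : ℤ → ℂ) (Fv0 : ℂ) (hf : ℤ → ℝ)
    (hγ : γ ^ 2 = s 0 ^ 2 + s (-1) ^ 2) (hγ0 : 0 ≤ γ)
    (hσ : σ = s (-1) ^ 2 / (d (-1) - d 0) + s 0 ^ 2 / (d 1 - d 0)) (hΛ : 0 < Λ)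
    (hFv0 : Fv0 = -(Λ : ℂ) * ((d 0 : ℂ) * x 0) -
      (gt : ℂ) * (Λ : ℂ) * ((s (0 - 1) : ℂ) * x (0 - 1) - (s 0 : ℂ) * x (0 + 1)))
    (hhf : ∀ J, hf J = if J = 1 then -(gt * s 0 / (d 1 - d 0))
      else if J = -1 then gt * s (-1) / (d (-1) - d 0) else 0) :
    2 * (Fv0 * conj (x 0)).re ≤ -2 * Λ * (d 0 + gt ^ 2 * σ) * ‖x 0‖ ^ 2 +
      2 * (|gt| * Λ * γ * ‖x 0‖ * Real.sqrt (∑ J ∈ W.erase 0, ‖x J - (hf J : ℂ) * x 0‖ ^ 2)) := by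
  classical
  have h1W' : (1 : ℤ) ∈ W.erase 0 := Finset.mem_erase.2 ⟨by norm_num, h1⟩
  have hm1W' : (-1 : ℤ) ∈ W.erase 0 := Finset.mem_erase.2 ⟨by norm_num, hm1⟩
  have hf1 : hf 1 = -(gt * s 0 / (d 1 - d 0)) := by rw [hhf]; simp
  have hfm1 : hf (-1) = gt * s (-1) / (d (-1) - d 0) := by rw [hhf]; norm_num
  -- the slow feed `X₁ = s₋₁ r₋₁ − s₀ r₁` and its size
  obtain ⟨X₁, hX₁def⟩ : ∃ X₁ : ℂ, X₁ = (s (-1) : ℂ) * (x (-1) - (hf (-1) : ℂ) * x 0) -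
      (s 0 : ℂ) * (x 1 - (hf 1 : ℂ) * x 0) := ⟨_, rfl⟩
  obtain ⟨Y, hYdef⟩ : ∃ Y : ℝ, Y = Real.sqrt (∑ J ∈ W.erase 0, ‖x J - (hf J : ℂ) * x 0‖ ^ 2) := ⟨_, rfl⟩
  have hX₁ : ‖X₁‖ ≤ γ * Y := by
    have h := norm_sub_two_le_sqrt (s (-1)) (s 0) (x (-1) - (hf (-1) : ℂ) * x 0) (x 1 - (hf 1 : ℂ) * x 0)
    have e : Real.sqrt (s (-1) ^ 2 + s 0 ^ 2) = γ := by rw [← Real.sqrt_sq hγ0, hγ, add_comm]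
    rw [e, ← hX₁def] at h
    refine h.trans (mul_le_mul_of_nonneg_left ?_ hγ0)
    rw [hYdef]
    refine Real.sqrt_le_sqrt ?_
    have hsub : ({-1, 1} : Finset ℤ) ⊆ W.erase 0 := by
      intro J hJ
      simp only [Finset.mem_insert, Finset.mem_singleton] at hJ
      rcases hJ with rfl | rfl
      · exact hm1W'
      · exact h1W'
    have := Finset.sum_le_sum_of_subset_of_nonneg hsub (fun J _ _ => sq_nonneg ‖x J - (hf J : ℂ) * x 0‖)
    rw [Finset.sum_pair (by norm_num)] at this
    exact this
  -- KEY IDENTITY (second-order slaving): `s₋₁ x₋₁ − s₀ x₁ = X₁ + gt σ x₀`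
  have hslow_id : (s (-1) : ℂ) * x (-1) - (s 0 : ℂ) * x 1 = X₁ + ((gt * σ : ℝ) : ℂ) * x 0 := by
    rw [hX₁def, hf1, hfm1, hσ]
    push_cast
    ring
  have e0 : Fv0 = -(Λ : ℂ) * ((d 0 : ℂ) * x 0) - (gt : ℂ) * (Λ : ℂ) * (X₁ + ((gt * σ : ℝ) : ℂ) * x 0) := by
    rw [hFv0, ← hslow_id]; norm_num
  have e1 : Fv0 * conj (x 0) = -(((Λ * (d 0 + gt ^ 2 * σ) : ℝ) : ℂ) * (x 0 * conj (x 0))) -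
      ((gt * Λ : ℝ) : ℂ) * (X₁ * conj (x 0)) := by
    rw [e0]; push_cast; ring
  rw [← hYdef, e1, Complex.sub_re, Complex.neg_re, Complex.mul_conj', ← Complex.ofReal_pow, ← Complex.ofReal_mul,
    Complex.ofReal_re, Complex.re_ofReal_mul]
  have hY0 : 0 ≤ Y := by rw [hYdef]; exact Real.sqrt_nonneg _
  have hb : |(X₁ * conj (x 0)).re| ≤ γ * Y * ‖x 0‖ := ((Complex.abs_re_le_norm _).trans
    (le_of_eq (by rw [norm_mul, Complex.norm_conj]))).trans (mul_le_mul_of_nonneg_right hX₁ (norm_nonneg _))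
  have hb' : -(gt * Λ * (X₁ * conj (x 0)).re) ≤ |gt| * Λ * (γ * Y * ‖x 0‖) := by
    have h2 : |gt * Λ * (X₁ * conj (x 0)).re| ≤ |gt| * Λ * (γ * Y * ‖x 0‖) := by
      rw [abs_mul, abs_mul, abs_of_pos hΛ]
      exact mul_le_mul_of_nonneg_left hb (by positivity)
    exact (neg_le_abs _).trans h2
  linarith only [hb']

end

end Summit.AnomalousDissipation.AnomalousDissipation.Theorems.SolenoidalFractalHomogenisation.RealisedQuasiStaticCellLaw
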